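import Literature.MathematicalPhysics.QuantumFieldTheory.Balaban1983to89.Beta.AveragingWardJets
import Literature.MathematicalPhysics.QuantumFieldTheory.Balaban1983to89.Beta.AveragingHessianJets

/-!
# `Balaban1983to89.Beta.AveragingGaugeModes` — the GAUGE-DIRECTION JETS `W₀ = d`, `W₁`, `W₂` of the linearised
# gauge action `W(B)λ(b) = Ad(e^{B_b})λ(b₊) − λ(b₋)` as letter one-forms, their CERTIFICATE as the two-jet of the
# conjugation `t ↦ e^{tB}λe^{−tB}`, and the first two orders of the intertwining identity «averaging ∘ fine gauge
# mode = coarse gauge mode ∘ restriction» in this language (corollaries of node 5 / node 8), v1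

HONEST FRAMING (page 1, mandatory).  This leaf belongs to the β sub-cell of the Bałaban audit, whose END STATEMENT is:
discharging the one-loop hypothesis `FlowStep.BetaPertH` (read at END-STATEMENT grade, RULING (R6)) makes Bałaban's
ultraviolet stability theorem for 4-d lattice Yang–Mills ([Balaban1989LargeFieldII], Thm. 1 p. 355 (B16))
UNCONDITIONAL inside this package — a real constructive-QFT result; it is NOT the continuum limit and NOT the Clay
problem.  Gloss 2: EVERYTHING below is kernel-proved [folklore] algebra of finite sums and two-jet asymptotics
(`=o[𝓝 0]`) of products of exponentials in a complete normed algebra; NOTHING is cited as a fact.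
[Balaban1985Averaging] (= B7) and [Balaban1985BackgroundPropagators] (= B9) are named only to say WHICH objects are
being typed; the manuscripts under audit are not citable for their disputed steps and no programme-internal claim
enters.

ABSOLUTE RULE (cell charter, verbatim): «No internally-minted statement may enter as a cited fact. Every hypothesis is
either kernel-proved in this package or a verbatim quotation of a PUBLISHED theorem with page reference. The
manuscript(s) under audit are NOT citable for their own disputed steps — they are the thing under adjudication;
programme-internal (2001/route/tribunal) claims are never citable.»  Accordingly NO declaration below is a
`def … : Prop` carrying a citation and no hypothesis of any theorem is a printed statement: every declaration is
[folklore]; printed displays are object LOCATORS only.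

THE PRINTED OBJECTS (locators only; NOTHING printed is asserted, at any order).  B9 p.393 (before (3.17)), on the
fluctuation `U′` standing on the LEFT of the background `U` (node 7a's product chart; β-lead RULING (R25-2)): «the
configuration U′ = e^{iηA} transforms … under a gauge transformation u, i.e., U′^u(x,x′) = u(x)U′(x,x′)R(U(x,x′))
u⁻¹(x′), and if u = e^{iλ}, then the part of this transformation linear in A and λ is given by A^λ = A − Dλ» — the
LINEARISED GAUGE ACTION `D = D_U` on gauge functions, `(D_U λ)(b) = R(U_b)λ(b₊) − λ(b₋)` with `R` the adjoint action
(our reading of the display; `η`-factors dropped).  B9 p.418 (3.114), AS PRINTED (glyphs corrected in v1.0.2 after the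
page-image XREAD C-lit2g19-8; v1 carried an OCR reconstruction differing in three glyphs): «(QD^{L⁻¹}λ)(c) =
R̄_c(Q′λ)(c₊) − (Q′λ)(c₋) = (D_Ū Q′λ)(c)», where `R̄_c = R(Ū_c)` by the two printed lines preceding it — the averaging
INTERTWINES fine and coarse gauge modes; iterated as (3.115).  B7 p.19 (11) «Ū^u = (Ū)^u» and (14)/(15) (the averaging whose letter functionals node 5 / node 7a DEFINE;
their verbatim spans are in those headers).  READING, not a quotation: for the averaging (15) typed in this lineage
the coarse gauge function is the RESTRICTION of `u` to the block base points (node 5 `linAvg_grad` is the first-order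
witness); B9's (3.113) carries an extra block rotation `R_y`, and ITS `Q′λ` is the transported block mean
(3.18)–(3.19) — an object NOT typed in this lineage.

THE DICTIONARY (informal; what the declarations below are the letters of).  Write `U_b = e^{B_b}` and, per bond
`b = (κ, x)` with `b₋ = x`, `b₊ = x + e_κ`,
    `W(B)λ(b) := Ad(e^{B_b}) λ(b₊) − λ(b₋) = W₀λ(b) + W₁(B)λ(b) + W₂(B)λ(b) + O(B³)`,
    `W₀ = d` (node 5 `grad`),   `W₁(B)λ(b) = [B_b, λ(b₊)]` (`gmode1`),   `W₂(B)λ(b) = ½[B_b, [B_b, λ(b₊)]]` (`½ • gmode2two`).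
On a coarse bond `c = (μ, y)` with `c₋ = L•y`, `c₊ = L•y + L•e_μ` the SAME series with the restricted gauge function
`λ̄(c∓) = λ(c∓)` gives `W̄₀λ̄` (`cgmode0`), `W̄₁(B̄)λ̄` (`cgmode1`), `2•W̄₂(B̄)λ̄` (`cgmode2two`).  In the product chart a
background gauge transformation by `u = e^{sλ}` is, to first order in `s`, the FLUCTUATION `−s·W(B)λ` (the display
above: `A ↦ A − Dλ`), and by (11) the coarse datum responds by `−s·W̄(B̄(B))λ̄`; hence, writing the linearised
averaging of fluctuations as `Q(B) := D_W log[Φ_c(e^W e^B) Φ_c(e^B)⁻¹]|_{W = 0} = Z + V(·, B) + T₂(·, B, B) + …`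
(`Z` = node 5 `linAvg`, `V` = node 7a `vhU` up to its landed normalisation `2L^{2d}`, `T₂` = the THIRD jet, not typed)
and `B̄(B) = ZB + H(B, B) + O(B³)`, the intertwining identity `Q(B)·W(B)λ = W̄(B̄(B))λ̄` reads ORDER BY ORDER
    (B⁰) `Z(W₀λ) = #box • W̄₀λ̄`                                   — node 5 `linAvg_grad`; here `linAvg_grad_eq_cgmode0`;
    (B¹) `Z(W₁(B)λ) + V(W₀λ, B) = W̄₁(ZB)λ̄` (landed factor `2L^d`) — node 8 (W-V1) `vhU_grad_left`; here
         `vhU_grad_add_linAvg_gmode1`;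
    (B²) `Z(W₂(B)λ) + V(W₁(B)λ, B) + T₂(W₀λ, B, B) = W̄₁(H(B,B))λ̄ + W̄₂(ZB)λ̄` — NOT typed (needs `T₂`).
This is the letter content of (3.114) for the averaging (15) at `U = 1`, orders `B⁰` and `B¹`.

WHAT IS PROVED (all [folklore], sorry-free):
§1 THE JETS AS ONE-FORMS over any ring: `gmode1`, `gmode2two`, the coarse twins `cgmode0`, `cgmode1`, `cgmode2two`,
   evaluation lemmas, additivity in `λ`, the BRIDGE `gmode1 B λ = −endC λ B` to node 8's forward-endpoint pairing, and
   the LETTER-BASIS evaluations `gmode1_single` / `gmode2two_single` (support `{b = f, z = f₊}`: the colour-structured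
   kernels of `W₁`, `2W₂` before any stripping convention is chosen).
§2 THE CERTIFICATE in a complete normed `𝕜`-algebra (`𝕜 = ℝ` or `ℂ`), on node 7b's log-free two-jet calculus
   (`AddJet`, `MulJet`): a generic conjugation lemma `addJet_conj_of_mulJet` (`F λ G − λ` has additive two-jet
   `(Pλ + λP′, Rλ + λR′ + PλP′)` when `F = 1 + tP + t²R + o`, `G = 1 + tP′ + t²R′ + o`), the exponential jets
   `mulJet_exp_smul` / `mulJet_exp_neg_smul`, and **`addJet_conj_exp`**: `e^{tB} λ e^{−tB} − λ = t•[B, λ] +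
   t²•½[B, [B, λ]] + o(t²)`; per bond **`addJet_gaugeMode`**: `W(tB)λ(b) − W₀λ(b) = t•W₁(B)λ(b) + t²•W₂(B)λ(b) + o(t²)`
   — what makes `gmode1` / `½•gmode2two` THE gauge-direction jets rather than ad hoc polynomials; and the coarse twin
   `addJet_coarseGaugeMode` (same series, restricted gauge function).
§3 THE INTERTWINING IDENTITY, ORDERS `B⁰`, `B¹`, in W-language (corollaries with new conclusions; node 5 / node 8 are
   used BY NAME, not restated): `linAvg_grad_eq_cgmode0`; **`vhU_grad_add_linAvg_gmode1`**:
   `vhU (grad λ) B L μ y + (2L^d) • linAvg (gmode1 B λ) L μ y = (2L^d) • cgmode1 L (linAvg B L) λ μ y` (also solved for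
   `Z(W₁(B)λ)`: `linAvg_gmode1_eq`; helper `linAvg_negForm`); and the
   initial-endpoint twin `vhU_grad_right_add_linAvg` of node 8 (W-V2) in the same shape (pure-gauge BACKGROUND shift at
   fixed fluctuation: the law behind node 8b's (S-V)).

NOT PROVED, NOT CLAIMED: (B²) and anything involving the third averaging jet `T₂`; B7 (11) at any order beyond the two
displayed corollaries; the group-level map `U ↦ W(U)` beyond its two-jet at `U = 1`; B9's block-rotated averaging
(3.113) and its `Q′` (3.18)–(3.19); any colour-stripped / packed kernel form of `W₁`, `W₂` (a convention for the
consumer to fix); anything about gauge slices, Faddeev–Popov factors or determinants (the β-lead's journal finding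
F-lead-g12-1 of 2026-08-19, which names «the gauge-direction jets W₁/W₂» as wanted vocabulary, is the TRIGGER of this
leaf — a journal event, not a source; nothing of it is asserted here); `BetaPertH`.

Provenance: pub-balaban β sub-cell, ANALYSIS PROVER AN1 lineage (gen 12, node 10 AVERAGING-GAUGE-MODES).  Imports node 8
`Beta.AveragingWardJets` (⇒ 7a, 5) and node 7b `Beta.AveragingHessianJets` (the jet calculus).  Versions: v1 = p190789
(b5416bbd18a8); v1.0.1 = docstring, B16 Thm 1 page locator p. 355 (XREAD C-lit3g21-1 D1); v1.0.2 = docstring, (3.114) printed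
glyphs (XREAD C-lit2g19-8 D1); declarations byte-identical since v1.  NOT summit progress.
-/

namespace Literature.MathematicalPhysics.QuantumFieldTheory.Balaban1983to89.Beta.AveragingGaugeModes

open NormedSpace Filter Topology Asymptotics
open Literature.MathematicalPhysics.QuantumFieldTheory.Balaban1983to89.Beta.AffineAveraging
open Literature.MathematicalPhysics.QuantumFieldTheory.Balaban1983to89.Beta.AveragingContours
open Literature.MathematicalPhysics.QuantumFieldTheory.Balaban1983to89.Beta.AveragingHessianKernels
open Literature.MathematicalPhysics.QuantumFieldTheory.Balaban1983to89.Beta.AveragingWardJets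
  (endC iniC endC_apply iniC_apply vhU_grad_left vhU_grad_right linAvg_subForm linAvg_zeroForm linAvg_addForm)
open Literature.MathematicalPhysics.QuantumFieldTheory.Balaban1983to89.Beta.AveragingHessianJets
  (AddJet MulJet addJet_linear isLittleO_cube_sq isLittleO_four_sq isBigO_self_one)

noncomputable section

/-! ## §1 The gauge-direction jets as one-forms -/

section Forms

variable {d : ℕ} {𝔸 : Type*} [Ring 𝔸]

/-- [folklore] `W₁(B)λ`: the one-form `b = (κ, x) ↦ [B_b, λ(b₊)]`, `b₊ = x + e_κ` — the first `B`-jet of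
`Ad(e^{B_b})λ(b₊) − λ(b₋)`. -/
def gmode1 (B : Form1 d 𝔸) (lam : (Fin d → ℤ) → 𝔸) : Form1 d 𝔸 := fun κ x => comm (B κ x) (lam (x + unitVec κ))

/-- [folklore] `2•W₂(B)λ`: the one-form `b ↦ [B_b, [B_b, λ(b₊)]]` (TWICE the second `B`-jet; the factor `½` is
applied in §2 over a field). -/
def gmode2two (B : Form1 d 𝔸) (lam : (Fin d → ℤ) → 𝔸) : Form1 d 𝔸 :=
  fun κ x => comm (B κ x) (comm (B κ x) (lam (x + unitVec κ)))

/-- [folklore] `W̄₀λ̄` on the coarse bond `(μ, y)`: the RESTRICTED gauge function's coarse difference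
`λ(L•y + L•e_μ) − λ(L•y)`. -/
def cgmode0 (L : ℕ) (lam : (Fin d → ℤ) → 𝔸) (μ : Fin d) (y : Fin d → ℤ) : 𝔸 :=
  lam ((L : ℤ) • y + (L : ℤ) • unitVec μ) - lam ((L : ℤ) • y)

/-- [folklore] `W̄₁(B̄)λ̄` on the coarse bond `(μ, y)`: `[B̄_{(μ,y)}, λ(c₊)]`, `c₊ = L•y + L•e_μ`. -/
def cgmode1 (L : ℕ) (Bbar : Form1 d 𝔸) (lam : (Fin d → ℤ) → 𝔸) (μ : Fin d) (y : Fin d → ℤ) : 𝔸 :=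
  comm (Bbar μ y) (lam ((L : ℤ) • y + (L : ℤ) • unitVec μ))

/-- [folklore] `2•W̄₂(B̄)λ̄` on the coarse bond `(μ, y)`: `[B̄, [B̄, λ(c₊)]]`. -/
def cgmode2two (L : ℕ) (Bbar : Form1 d 𝔸) (lam : (Fin d → ℤ) → 𝔸) (μ : Fin d) (y : Fin d → ℤ) : 𝔸 :=
  comm (Bbar μ y) (comm (Bbar μ y) (lam ((L : ℤ) • y + (L : ℤ) • unitVec μ)))

/-- [folklore] Evaluation of `gmode1`. -/
@[simp] theorem gmode1_apply (B : Form1 d 𝔸) (lam : (Fin d → ℤ) → 𝔸) (κ : Fin d) (x : Fin d → ℤ) :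
    gmode1 B lam κ x = comm (B κ x) (lam (x + unitVec κ)) := rfl

/-- [folklore] Evaluation of `gmode2two`. -/
@[simp] theorem gmode2two_apply (B : Form1 d 𝔸) (lam : (Fin d → ℤ) → 𝔸) (κ : Fin d) (x : Fin d → ℤ) :
    gmode2two B lam κ x = comm (B κ x) (comm (B κ x) (lam (x + unitVec κ))) := rfl

/-- [folklore] Evaluation of `cgmode0`. -/
@[simp] theorem cgmode0_apply (L : ℕ) (lam : (Fin d → ℤ) → 𝔸) (μ : Fin d) (y : Fin d → ℤ) :
    cgmode0 L lam μ y = lam ((L : ℤ) • y + (L : ℤ) • unitVec μ) - lam ((L : ℤ) • y) := rfl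

/-- [folklore] Evaluation of `cgmode1`. -/
@[simp] theorem cgmode1_apply (L : ℕ) (Bbar : Form1 d 𝔸) (lam : (Fin d → ℤ) → 𝔸) (μ : Fin d) (y : Fin d → ℤ) :
    cgmode1 L Bbar lam μ y = comm (Bbar μ y) (lam ((L : ℤ) • y + (L : ℤ) • unitVec μ)) := rfl

/-- [folklore] Evaluation of `cgmode2two`. -/
@[simp] theorem cgmode2two_apply (L : ℕ) (Bbar : Form1 d 𝔸) (lam : (Fin d → ℤ) → 𝔸) (μ : Fin d) (y : Fin d → ℤ) :
    cgmode2two L Bbar lam μ y = comm (Bbar μ y) (comm (Bbar μ y) (lam ((L : ℤ) • y + (L : ℤ) • unitVec μ))) := rfl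

/-- [folklore] `gmode2two` is `gmode1` iterated on the bond letter: `2W₂(B)λ(b) = [B_b, W₁(B)λ(b)]`. -/
theorem gmode2two_eq_comm_gmode1 (B : Form1 d 𝔸) (lam : (Fin d → ℤ) → 𝔸) (κ : Fin d) (x : Fin d → ℤ) :
    gmode2two B lam κ x = comm (B κ x) (gmode1 B lam κ x) := rfl

/-- [folklore] The double commutator, expanded. -/
theorem comm_comm_eq (B lam : 𝔸) : comm B (comm B lam) = B * B * lam + lam * (B * B) - 2 • (B * lam * B) := by
  simp only [AveragingHessianKernels.comm]
  noncomm_ring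

/-- [folklore] BRIDGE to node 8: `W₁(B)λ = −endC λ B` (node 8's forward-endpoint pairing `[λ(b₊), B_b]`). -/
theorem gmode1_eq_neg_endC (B : Form1 d 𝔸) (lam : (Fin d → ℤ) → 𝔸) : gmode1 B lam = -endC lam B := by
  funext κ x
  simp only [gmode1_apply, Pi.neg_apply, endC_apply, AveragingHessianKernels.comm]
  abel

/-- [folklore] `W₁` is additive in the gauge function. -/
theorem gmode1_add_right (B : Form1 d 𝔸) (lam lam' : (Fin d → ℤ) → 𝔸) :
    gmode1 B (lam + lam') = gmode1 B lam + gmode1 B lam' := by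
  funext κ x
  simp only [gmode1_apply, Pi.add_apply, comm_add_right]

/-- [folklore] `W₁` is additive in the background letter. -/
theorem gmode1_add_left (B B' : Form1 d 𝔸) (lam : (Fin d → ℤ) → 𝔸) :
    gmode1 (B + B') lam = gmode1 B lam + gmode1 B' lam := by
  funext κ x
  simp only [gmode1_apply, Pi.add_apply, comm_add_left]

/-- [folklore] `2W₂` is additive in the gauge function. -/
theorem gmode2two_add_right (B : Form1 d 𝔸) (lam lam' : (Fin d → ℤ) → 𝔸) :
    gmode2two B (lam + lam') = gmode2two B lam + gmode2two B lam' := by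
  funext κ x
  simp only [gmode2two_apply, Pi.add_apply, comm_add_right]

/-- [folklore] `W̄₁` is additive in the coarse letter. -/
theorem cgmode1_add_left (L : ℕ) (Bbar Bbar' : Form1 d 𝔸) (lam : (Fin d → ℤ) → 𝔸) (μ : Fin d) (y : Fin d → ℤ) :
    cgmode1 L (Bbar + Bbar') lam μ y = cgmode1 L Bbar lam μ y + cgmode1 L Bbar' lam μ y := by
  simp only [cgmode1_apply, Pi.add_apply, comm_add_left]

/-- [folklore] LETTER BASIS: on the bond letter `δ_f w` and the site letter `δ_z v`, `W₁` is supported on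
`{b = f, z = f₊}` with value `[w, v]` — the colour-structured kernel of `W₁` before any stripping convention. -/
theorem gmode1_single (f : Bond d) (w : 𝔸) (z : Fin d → ℤ) (v : 𝔸) (κ : Fin d) (x : Fin d → ℤ) :
    gmode1 (single f w) (fun x' => if x' = z then v else 0) κ x
      = if (κ, x) = f ∧ x + unitVec κ = z then comm w v else 0 := by
  simp only [gmode1_apply, single_apply]
  by_cases h : (κ, x) = f
  · by_cases h' : x + unitVec κ = z
    · simp [h, h']
    · simp [h, h']
  · simp [h]

/-- [folklore] LETTER BASIS for `2W₂`: support `{b = f, z = f₊}`, value `[w, [w, v]]`. -/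
theorem gmode2two_single (f : Bond d) (w : 𝔸) (z : Fin d → ℤ) (v : 𝔸) (κ : Fin d) (x : Fin d → ℤ) :
    gmode2two (single f w) (fun x' => if x' = z then v else 0) κ x
      = if (κ, x) = f ∧ x + unitVec κ = z then comm w (comm w v) else 0 := by
  simp only [gmode2two_apply, single_apply]
  by_cases h : (κ, x) = f
  · by_cases h' : x + unitVec κ = z
    · simp [h, h']
    · simp [h, h']
  · simp [h]

end Forms

/-! ## §2 The certificate: `W₁`, `W₂` are the two-jet of `t ↦ Ad(e^{tB_b})λ(b₊) − λ(b₋)` -/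

section Jet

variable {𝕜 : Type*} [RCLike 𝕜] {𝔸 : Type*} [NormedRing 𝔸] [NormedAlgebra 𝕜 𝔸]

/-- [folklore] CONJUGATION OF A CONSTANT BY TWO MULTIPLICATIVE JETS: if `F = 1 + tP + t²R + o(t²)` and
`G = 1 + tP′ + t²R′ + o(t²)` then `F·λ·G − λ = t•(Pλ + λP′) + t²•(Rλ + λR′ + PλP′) + o(t²)`. -/
theorem addJet_conj_of_mulJet {F G : 𝕜 → 𝔸} {P R P' R' : 𝔸} (hF : MulJet F P R) (hG : MulJet G P' R')
    (lam : 𝔸) :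
    AddJet (fun t => F t * lam * G t - lam) (P * lam + lam * P') (R * lam + lam * R' + P * lam * P') := by
  have hGO : (fun t => lam * G t) =O[𝓝 (0 : 𝕜)] fun _ => (1 : 𝕜) :=
    ((isBigO_const_const lam (one_ne_zero (α := 𝕜)) _).mul hG.isBigO_one).congr_right fun _ => mul_one _
  -- term 1: (F − 1 − tP − t²R)·(λ·G) = o(t²)·O(1)
  have h1 : (fun t => (F t - 1 - t • P - t ^ 2 • R) * (lam * G t)) =o[𝓝 (0 : 𝕜)] fun t => t ^ 2 * (1 : 𝕜) :=
    hF.mul_isBigO hGO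
  -- term 2: ((1 + tP + t²R)·λ)·(G − 1 − tP′ − t²R′) = O(1)·o(t²)
  have hpoly : (fun t : 𝕜 => ((1 : 𝔸) + t • P + t ^ 2 • R) * lam) =O[𝓝 (0 : 𝕜)] fun _ => (1 : 𝕜) := by
    have hj : MulJet (fun t : 𝕜 => (1 : 𝔸) + t • P + t ^ 2 • R) P R := by
      exact (isLittleO_zero _ _).congr_left fun t => by beta_reduce; module
    exact (hj.isBigO_one.mul (isBigO_const_const lam (one_ne_zero (α := 𝕜)) _)).congr_right fun _ => mul_one _
  have h2 : (fun t => (((1 : 𝔸) + t • P + t ^ 2 • R) * lam) * (G t - 1 - t • P' - t ^ 2 • R'))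
      =o[𝓝 (0 : 𝕜)] fun t => (1 : 𝕜) * t ^ 2 := hpoly.mul_isLittleO hG
  -- term 3: the cubic and quartic leftovers
  have h3 : (fun t : 𝕜 => t ^ 3 • (P * lam * R' + R * lam * P') + t ^ 4 • (R * lam * R'))
      =o[𝓝 (0 : 𝕜)] fun t => t ^ 2 := by
    refine IsLittleO.add ?_ ?_
    · exact ((isLittleO_cube_sq (𝕜 := 𝕜)).smul_isBigO
        (isBigO_const_const (P * lam * R' + R * lam * P') (one_ne_zero (α := 𝕜)) _)).congr
          (fun t => rfl) (fun t => by simp)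
    · exact ((isLittleO_four_sq (𝕜 := 𝕜)).smul_isBigO
        (isBigO_const_const (R * lam * R') (one_ne_zero (α := 𝕜)) _)).congr
          (fun t => rfl) (fun t => by simp)
  have h12 := (h1.congr_right fun t => mul_one (t ^ 2)).add (h2.congr_right fun t => one_mul (t ^ 2))
  refine (h12.add h3).congr_left fun t => ?_
  simp only [sub_mul, mul_sub, add_mul, one_mul, mul_one, smul_mul_assoc, mul_smul_comm, smul_smul,
    smul_add, mul_assoc]
  ring_nf
  abel

variable [CompleteSpace 𝔸]

/-- [folklore] `e^{tB} = 1 + tB + t²•½B² + o(t²)` (node 7b's `AddJet.mulJet_exp` on the linear curve). -/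
theorem mulJet_exp_smul (B : 𝔸) : MulJet (fun t : 𝕜 => exp (t • B)) B ((2 : 𝕜)⁻¹ • (B * B)) :=
  (addJet_linear (𝕜 := 𝕜) B).mulJet_exp.of_eq rfl (by rw [zero_add])

/-- [folklore] `e^{−tB} = 1 − tB + t²•½B² + o(t²)`. -/
theorem mulJet_exp_neg_smul (B : 𝔸) : MulJet (fun t : 𝕜 => exp (-(t • B))) (-B) ((2 : 𝕜)⁻¹ • (B * B)) := by
  have h := (addJet_linear (𝕜 := 𝕜) (-B)).mulJet_exp.of_eq rfl (by rw [zero_add, neg_mul_neg])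
  exact h.congr (Eventually.of_forall fun t => by rw [smul_neg])

/-- [folklore] **THE CONJUGATION JET**: `e^{tB} λ e^{−tB} − λ = t•[B, λ] + t²•½[B, [B, λ]] + o(t²)`. -/
theorem addJet_conj_exp (B lam : 𝔸) :
    AddJet (fun t : 𝕜 => exp (t • B) * lam * exp (-(t • B)) - lam) (comm B lam)
      ((2 : 𝕜)⁻¹ • comm B (comm B lam)) := by
  have h := addJet_conj_of_mulJet (mulJet_exp_smul (𝕜 := 𝕜) B) (mulJet_exp_neg_smul (𝕜 := 𝕜) B) lam
  have hP : B * lam + lam * -B = comm B lam := by simp only [AveragingHessianKernels.comm, mul_neg]; abel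
  have hR : (2 : 𝕜)⁻¹ • (B * B) * lam + lam * ((2 : 𝕜)⁻¹ • (B * B)) + B * lam * -B
      = (2 : 𝕜)⁻¹ • comm B (comm B lam) := by
    rw [comm_comm_eq, smul_sub, smul_add, smul_mul_assoc, mul_smul_comm, mul_neg, ← Nat.cast_smul_eq_nsmul 𝕜,
      smul_smul, Nat.cast_ofNat, inv_mul_cancel₀ (two_ne_zero (α := 𝕜)), one_smul]
    abel
  rw [hP, hR] at h
  exact h

/-- [folklore] **THE GAUGE-DIRECTION JETS, CERTIFIED**: per bond `b = (κ, x)`,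
`(Ad(e^{tB_b})λ(b₊) − λ(b₋)) − W₀λ(b) = t•W₁(B)λ(b) + t²•W₂(B)λ(b) + o(t²)` with `W₀ = grad`, `W₁ = gmode1`,
`W₂ = ½•gmode2two`. -/
theorem addJet_gaugeMode {d : ℕ} (B : Form1 d 𝔸) (lam : (Fin d → ℤ) → 𝔸) (κ : Fin d) (x : Fin d → ℤ) :
    AddJet (fun t : 𝕜 => (exp (t • B κ x) * lam (x + unitVec κ) * exp (-(t • B κ x)) - lam x) - grad lam κ x)
      (gmode1 B lam κ x) ((2 : 𝕜)⁻¹ • gmode2two B lam κ x) := by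
  have h := addJet_conj_exp (𝕜 := 𝕜) (B κ x) (lam (x + unitVec κ))
  refine (h.congr_left fun t => ?_)
  simp only [grad, gmode1_apply, gmode2two_apply]
  abel

/-- [folklore] THE COARSE TWIN OF THE CERTIFICATE: on the coarse bond `c = (μ, y)` (`c₋ = L•y`, `c₊ = L•y + L•e_μ`) the
same series with the RESTRICTED gauge function, `(Ad(e^{tB̄_c})λ(c₊) − λ(c₋)) − W̄₀λ̄(c) = t•W̄₁(B̄)λ̄(c) +
t²•W̄₂(B̄)λ̄(c) + o(t²)` with `W̄₁ = cgmode1`, `W̄₂ = ½•cgmode2two`. -/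
theorem addJet_coarseGaugeMode {d : ℕ} (L : ℕ) (Bbar : Form1 d 𝔸) (lam : (Fin d → ℤ) → 𝔸) (μ : Fin d)
    (y : Fin d → ℤ) :
    AddJet (fun t : 𝕜 => (exp (t • Bbar μ y) * lam ((L : ℤ) • y + (L : ℤ) • unitVec μ) * exp (-(t • Bbar μ y))
        - lam ((L : ℤ) • y)) - cgmode0 L lam μ y)
      (cgmode1 L Bbar lam μ y) ((2 : 𝕜)⁻¹ • cgmode2two L Bbar lam μ y) := by
  have h := addJet_conj_exp (𝕜 := 𝕜) (Bbar μ y) (lam ((L : ℤ) • y + (L : ℤ) • unitVec μ))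
  refine (h.congr_left fun t => ?_)
  simp only [cgmode0_apply, cgmode1_apply, cgmode2two_apply]
  abel

end Jet

/-! ## §3 The intertwining identity (3.114) for the averaging (15), orders `B⁰` and `B¹`, in W-language -/

section Intertwining

variable {d : ℕ} {𝔸 : Type*} [Ring 𝔸]

/-- [folklore] (B⁰) `Z(W₀λ) = #box • W̄₀λ̄` — node 5 `linAvg_grad` in the present vocabulary: the linear averaging of a
fine pure-gauge mode is the coarse pure-gauge mode of the RESTRICTED gauge function (times the block cardinality, the
landed normalisation of `linAvg`). -/
theorem linAvg_grad_eq_cgmode0 (lam : (Fin d → ℤ) → 𝔸) (L : ℕ) (μ : Fin d) (y : Fin d → ℤ) :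
    linAvg (grad lam) L μ y = (box d L).card • cgmode0 L lam μ y := by
  rw [linAvg_grad, cgmode0_apply]

/-- [folklore] `linAvg` of a negated form. -/
theorem linAvg_negForm (X : Form1 d 𝔸) (L : ℕ) (μ : Fin d) (y : Fin d → ℤ) : linAvg (-X) L μ y = -linAvg X L μ y := by
  have h := linAvg_subForm (0 : Form1 d 𝔸) X L μ y
  rwa [zero_sub, linAvg_zeroForm, zero_sub] at h

/-- [folklore] **(B¹) THE INTERTWINING IDENTITY AT FIRST ORDER IN THE BACKGROUND** (node 8 (W-V1) `vhU_grad_left`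
rearranged): `V(W₀λ, B) + Z(W₁(B)λ) = W̄₁(ZB)λ̄` with the landed normalisations, i.e.
`vhU (grad λ) B + (2L^d) • linAvg (gmode1 B λ) = (2L^d) • [linAvg B, λ(c₊)]`.  Reading: the fine gauge mode of the
fluctuation, pushed through the averaging to first order in `B`, is the coarse gauge mode built on the coarse letter
`ZB` with the restricted gauge function — (3.114) for (15) at order `B¹`. -/
theorem vhU_grad_add_linAvg_gmode1 (lam : (Fin d → ℤ) → 𝔸) (B : Form1 d 𝔸) (L : ℕ) (μ : Fin d) (y : Fin d → ℤ) :
    vhU (grad lam) B L μ y + (2 * (L : ℤ) ^ d) • linAvg (gmode1 B lam) L μ y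
      = (2 * (L : ℤ) ^ d) • cgmode1 L (linAvg B L) lam μ y := by
  rw [vhU_grad_left, gmode1_eq_neg_endC, linAvg_negForm, cgmode1_apply,
    comm_anticomm (linAvg B L μ y) (lam ((L : ℤ) • y + (L : ℤ) • unitVec μ))]
  simp only [smul_sub, smul_neg]
  abel

/-- [folklore] The same identity solved for `Z(W₁(B)λ)`. -/
theorem linAvg_gmode1_eq (lam : (Fin d → ℤ) → 𝔸) (B : Form1 d 𝔸) (L : ℕ) (μ : Fin d) (y : Fin d → ℤ) :
    (2 * (L : ℤ) ^ d) • linAvg (gmode1 B lam) L μ y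
      = (2 * (L : ℤ) ^ d) • cgmode1 L (linAvg B L) lam μ y - vhU (grad lam) B L μ y := by
  rw [← vhU_grad_add_linAvg_gmode1]
  abel

/-- [folklore] THE INITIAL-ENDPOINT TWIN (node 8 (W-V2) `vhU_grad_right` in the same shape): for a pure-gauge
BACKGROUND shift `B ↦ B + t·dλ` at fixed fluctuation `W` (NOT a gauge transformation of the pair — the law behind
node 8b's (S-V)), `vhU W (grad λ) + (2L^d) • linAvg (b ↦ [W_b, λ(b₋)]) = (2L^d) • [linAvg W, λ(c₋)]`. -/
theorem vhU_grad_right_add_linAvg (W : Form1 d 𝔸) (lam : (Fin d → ℤ) → 𝔸) (L : ℕ) (μ : Fin d) (y : Fin d → ℤ) :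
    vhU W (grad lam) L μ y + (2 * (L : ℤ) ^ d) • linAvg (fun κ x => comm (W κ x) (lam x)) L μ y
      = (2 * (L : ℤ) ^ d) • comm (linAvg W L μ y) (lam ((L : ℤ) • y)) := by
  have hini : (fun κ x => comm (W κ x) (lam x)) = -iniC lam W := by
    funext κ x
    simp only [Pi.neg_apply, iniC_apply, AveragingHessianKernels.comm]
    abel
  rw [vhU_grad_right, hini, linAvg_negForm, comm_anticomm (linAvg W L μ y) (lam ((L : ℤ) • y))]
  simp only [smul_sub, smul_neg]
  abel

end Intertwining

end

end Literature.MathematicalPhysics.QuantumFieldTheory.Balaban1983to89.Beta.AveragingGaugeModes
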